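import Literature.Analysis.FluidPDE.ElgindiPolarEnergy
import Literature.Analysis.FluidPDE.ElgindiWeightedIBP
import HarnessLib

/-!
# The radially weighted energy identity of the polar model operator ([Elgindi2021] §7.3,
Proposition 7.7 Step 1)

Topic `Literature/Analysis/FluidPDE`. Proof file (everything proved, no definitions, no named
facts) on the proof path of the named fact
`Literature.Analysis.FluidPDE.Elgindi.ElgindiGhoulMasmoudi2021_stabilityCore`
(`ElgindiStabilityDecomposition.lean`). T. M. Elgindi, Ann. of Math. 194 (2021) =
arXiv:1904.04795, §7.3 proof of Proposition 7.7, Step 1 "Only radial weights" (pp. 20–21):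

> "We start by multiplying (PolarBSL) by `Ψw²` and integrating (note that we are only putting a
> weight in `R` to begin with). We see:
> `α²|∂_RΨRw|² − (α²/2)(Ψ², ∂_R²(R²w²)) + (α(5+α)/2)(Ψ², ∂_R(Rw²)) + |∂_θΨw|² − 6|Ψ|² +
> ½|sec(θ)Ψw|² = (F, Ψw²)`."

Exactly this (with the misprints `|∂_θθΨw|² → |∂_θΨw|²`, `6|Ψ|² → 6|Ψw|²` of the printed display
corrected by the computation), for a general radial weight `W = w²` of class `C²` on `(0,∞)` and the
a-priori class `Ψ = cosθ·χ`, `χ ∈ C²(ℝ²)` compactly supported inside `R > 0` with `χ(R,0) = 0`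
(`integral_strip_ellipticOp_mul_self_weight`):
`∫∫L(Ψ)ΨW = α²∫∫W(R∂_RΨ)² − (α²/2)∫∫(R²W)″Ψ² + (α(5+α)/2)∫∫(RW)′Ψ² + ∫∫W(∂_θΨ)² − 6∫∫WΨ² + ½∫∫Wχ²`.
-/

noncomputable section

open MeasureTheory Set Real Filter Function intervalIntegral
open _root_.Topology

namespace Literature.Analysis.FluidPDE

namespace Elgindi

/-! ### Plane functions vanishing near the axis `R ≤ 0` times radial weights -/

/-- A compactly supported plane function whose topological support lies in `R > 0` vanishes for
`R < a`, some `a > 0`. [folklore] -/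
theorem exists_pos_forall_fst_lt_eq_zero {G : ℝ × ℝ → ℝ} (hs : HasCompactSupport G)
    (hsub : ∀ p ∈ tsupport G, 0 < p.1) : ∃ a : ℝ, 0 < a ∧ ∀ p : ℝ × ℝ, p.1 < a → G p = 0 := by
  rcases (tsupport G).eq_empty_or_nonempty with he | hne
  · exact ⟨1, one_pos, fun p _ => image_eq_zero_of_notMem_tsupport (by rw [he]; simp)⟩
  · obtain ⟨q, hq, hmin⟩ := hs.isCompact.exists_isMinOn hne continuous_fst.continuousOn
    refine ⟨q.1, hsub q hq, fun p hp => image_eq_zero_of_notMem_tsupport fun h => ?_⟩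
    have := hmin h
    simp only [mem_setOf_eq] at this
    linarith

/-- A radial weight continuous on `R > 0` times a continuous plane function vanishing for `R < a`
(`a > 0`) is continuous on the plane. [folklore] -/
theorem continuous_weight_mul₂ {W : ℝ → ℝ} (hW : ContinuousOn W (Ioi 0)) {g : ℝ × ℝ → ℝ} (hg : Continuous g)
    {a : ℝ} (ha : 0 < a) (hga : ∀ p : ℝ × ℝ, p.1 < a → g p = 0) : Continuous fun p : ℝ × ℝ => W p.1 * g p := by
  refine continuous_iff_continuousAt.2 fun p => ?_
  rcases lt_or_ge p.1 a with hp | hp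
  · have : (fun q : ℝ × ℝ => W q.1 * g q) =ᶠ[𝓝 p] fun _ => 0 := by
      have ho : IsOpen {q : ℝ × ℝ | q.1 < a} := isOpen_lt continuous_fst continuous_const
      exact Filter.eventuallyEq_of_mem (ho.mem_nhds hp) fun q hq => by simp [hga q hq]
    exact (continuousAt_const.congr this.symm)
  · have hp0 : 0 < p.1 := lt_of_lt_of_le ha hp
    exact ((hW.continuousAt (Ioi_mem_nhds hp0)).comp continuous_fst.continuousAt).mul hg.continuousAt

/-! ### The weighted energy identity -/

/-- **The radially weighted energy identity** (Proposition 7.7 Step 1, first display): for a weight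
`W ∈ C²((0,∞))`, `Ψ = cosθ·χ` with `χ ∈ C²(ℝ²)` compactly supported inside `R > 0` and `χ(R,0) = 0`,
and any real `α`,
`∫∫_strip L(Ψ)·Ψ·W = α²∫∫W(R∂_RΨ)² − (α²/2)∫∫(R²W)″Ψ² + (α(5+α)/2)∫∫(RW)′Ψ² + ∫∫W(∂_θΨ)² − 6∫∫WΨ² + ½∫∫Wχ²`.
[cite: Elgindi2021, §7.3 proof of Proposition 7.7, Step 1 (pp. 20–21 of arXiv:1904.04795)] -/
theorem integral_strip_ellipticOp_mul_self_weight (α : ℝ) {W : ℝ → ℝ} (hW : ContDiffOn ℝ 2 W (Ioi 0))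
    {χ : ℝ → ℝ → ℝ} (hχ : ContDiff ℝ 2 (uncurry χ)) (hs : HasCompactSupport (uncurry χ))
    (hpos : ∀ p ∈ tsupport (uncurry χ), 0 < p.1) (hχ0 : ∀ R, χ R 0 = 0) {Ψ : ℝ → ℝ → ℝ}
    (hΨ : Ψ = fun R θ => Real.cos θ * χ R θ) :
    ∫ p in strip, ellipticOp α Ψ p.1 p.2 * Ψ p.1 p.2 * W p.1 =
      α ^ 2 * (∫ p in strip, W p.1 * (p.1 * dz Ψ p.1 p.2) ^ 2) -
        α ^ 2 / 2 * (∫ p in strip, deriv (deriv fun R => R ^ 2 * W R) p.1 * Ψ p.1 p.2 ^ 2) +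
        α * (5 + α) / 2 * (∫ p in strip, deriv (fun R => R * W R) p.1 * Ψ p.1 p.2 ^ 2) +
        (∫ p in strip, W p.1 * dθ Ψ p.1 p.2 ^ 2) - 6 * (∫ p in strip, W p.1 * Ψ p.1 p.2 ^ 2) +
        (1 / 2) * ∫ p in strip, W p.1 * χ p.1 p.2 ^ 2 := by
  -- the weights on `(0,∞)`
  set M : ℝ → ℝ := fun R => R ^ 2 * W R with hM
  set N : ℝ → ℝ := fun R => R * W R with hN
  have hMd : ContDiffOn ℝ 2 M (Ioi 0) := (contDiffOn_id.pow 2).mul hW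
  have hNd : ContDiffOn ℝ 1 N (Ioi 0) := contDiffOn_id.mul (hW.of_le (by norm_num))
  have hWc : ContinuousOn W (Ioi 0) := hW.continuousOn
  have hM1 : ContDiffOn ℝ 1 (deriv M) (Ioi 0) := hMd.deriv_of_isOpen (m := 1) isOpen_Ioi (by norm_num)
  have hM2c : ContinuousOn (deriv (deriv M)) (Ioi 0) := (hM1.deriv_of_isOpen (m := 0) isOpen_Ioi (by norm_num)).continuousOn
  have hN1c : ContinuousOn (deriv N) (Ioi 0) := (hNd.deriv_of_isOpen (m := 0) isOpen_Ioi (by norm_num)).continuousOn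
  -- regularity and support of the profile
  have hχ1 : ContDiff ℝ 1 (uncurry χ) := hχ.of_le (by norm_num)
  have hΨ2 : ContDiff ℝ 2 (uncurry Ψ) := by rw [hΨ]; exact contDiff_cosProfile hχ
  have hΨs : HasCompactSupport (uncurry Ψ) := by rw [hΨ]; exact hasCompactSupport_cosProfile hs
  have hdzΨ : ContDiff ℝ 1 (uncurry (dz Ψ)) := contDiff_dz_of_contDiff (n := 1) hΨ2
  have hdzΨs : HasCompactSupport (uncurry (dz Ψ)) := hasCompactSupport_dz hΨs
  have hdθΨ : ContDiff ℝ 1 (uncurry (dθ Ψ)) := contDiff_dθ_of_contDiff (n := 1) hΨ2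
  have hdθΨs : HasCompactSupport (uncurry (dθ Ψ)) := hasCompactSupport_dθ_of hΨs
  have hdθχ : ContDiff ℝ 1 (uncurry (dθ χ)) := contDiff_dθ_of_contDiff (n := 1) hχ
  have cΨ : Continuous fun p : ℝ × ℝ => Ψ p.1 p.2 := hΨ2.continuous
  have cχ : Continuous fun p : ℝ × ℝ => χ p.1 p.2 := hχ.continuous
  have cdz : Continuous fun p : ℝ × ℝ => dz Ψ p.1 p.2 := hdzΨ.continuous
  have cdz2 : Continuous fun p : ℝ × ℝ => dz (dz Ψ) p.1 p.2 := continuous_dz hdzΨ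
  have cdθ : Continuous fun p : ℝ × ℝ => dθ Ψ p.1 p.2 := hdθΨ.continuous
  have cdθ2 : Continuous fun p : ℝ × ℝ => dθ (dθ Ψ) p.1 p.2 := (contDiff_dθ_of_contDiff (n := 0) hdθΨ).continuous
  have cdθχ : Continuous fun p : ℝ × ℝ => dθ χ p.1 p.2 := hdθχ.continuous
  -- vanishing near the axis
  obtain ⟨a, ha, hva⟩ := exists_pos_forall_fst_lt_eq_zero hs hpos
  have hvaχ : ∀ p : ℝ × ℝ, p.1 < a → χ p.1 p.2 = 0 := fun p hp => hva p hp
  have hvaΨ : ∀ p : ℝ × ℝ, p.1 < a → Ψ p.1 p.2 = 0 := fun p hp => by rw [hΨ]; simp [hvaχ p hp]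
  have hvadz : ∀ p : ℝ × ℝ, p.1 < a → dz Ψ p.1 p.2 = 0 := by
    intro p hp
    show deriv (fun R' => Ψ R' p.2) p.1 = 0
    have : (fun R' => Ψ R' p.2) =ᶠ[𝓝 p.1] fun _ => 0 :=
      Filter.eventuallyEq_of_mem (Iio_mem_nhds hp) fun R' hR' => hvaΨ (R', p.2) hR'
    rw [this.deriv_eq, deriv_const]
  have hvadθ : ∀ p : ℝ × ℝ, p.1 < a → dθ Ψ p.1 p.2 = 0 := by
    intro p hp
    show deriv (fun θ' => Ψ p.1 θ') p.2 = 0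
    have : (fun θ' => Ψ p.1 θ') = fun _ => 0 := funext fun θ' => hvaΨ (p.1, θ') hp
    rw [this, deriv_const]
  -- Dirichlet data and the radial bound of the support
  have hD0 : ∀ R, Ψ R 0 = 0 := fun R => by rw [hΨ]; simp [hχ0 R]
  have hD1 : ∀ R, Ψ R (π / 2) = 0 := fun R => by rw [hΨ]; simp
  -- the six integrands
  set A : ℝ × ℝ → ℝ := fun p => M p.1 * (-(dz (dz Ψ) p.1 p.2) * Ψ p.1 p.2) with hA
  set Bf : ℝ × ℝ → ℝ := fun p => N p.1 * (-(dz Ψ p.1 p.2) * Ψ p.1 p.2) with hBf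
  set C : ℝ × ℝ → ℝ := fun p => W p.1 * (-dθ (dθ Ψ) p.1 p.2 * Ψ p.1 p.2) with hC
  set D : ℝ × ℝ → ℝ := fun p => W p.1 * ((Real.cos p.2 * χ p.1 p.2 + Real.sin p.2 * dθ χ p.1 p.2) * (Real.cos p.2 * χ p.1 p.2)) with hD
  set E : ℝ × ℝ → ℝ := fun p => W p.1 * Ψ p.1 p.2 ^ 2 with hE
  set Z : ℝ × ℝ → ℝ := fun p => W p.1 * (p.1 * dz Ψ p.1 p.2) ^ 2 with hZ
  set M2 : ℝ × ℝ → ℝ := fun p => deriv (deriv M) p.1 * Ψ p.1 p.2 ^ 2 with hM2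
  set N1 : ℝ × ℝ → ℝ := fun p => deriv N p.1 * Ψ p.1 p.2 ^ 2 with hN1
  set Y : ℝ × ℝ → ℝ := fun p => W p.1 * dθ Ψ p.1 p.2 ^ 2 with hY
  set X : ℝ × ℝ → ℝ := fun p => W p.1 * χ p.1 p.2 ^ 2 with hX
  -- continuity (weight times a plane function vanishing for `R < a`) and compact support
  have hMc : ContinuousOn M (Ioi 0) := hMd.continuousOn
  have hNc : ContinuousOn N (Ioi 0) := hNd.continuousOn
  have cA : Continuous A := continuous_weight_mul₂ hMc (cdz2.neg.mul cΨ) ha fun p hp => by simp [hvaΨ p hp]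
  have cB : Continuous Bf := continuous_weight_mul₂ hNc (cdz.neg.mul cΨ) ha fun p hp => by simp [hvaΨ p hp]
  have cC : Continuous C := continuous_weight_mul₂ hWc (cdθ2.neg.mul cΨ) ha fun p hp => by simp [hvaΨ p hp]
  have cD : Continuous D := continuous_weight_mul₂ hWc (by fun_prop) ha fun p hp => by simp [hvaχ p hp]
  have cE : Continuous E := continuous_weight_mul₂ hWc (cΨ.pow 2) ha fun p hp => by simp [hvaΨ p hp]
  have cZ : Continuous Z := continuous_weight_mul₂ hWc (by fun_prop) ha fun p hp => by simp [hvadz p hp]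
  have cM2 : Continuous M2 := continuous_weight_mul₂ hM2c (cΨ.pow 2) ha fun p hp => by simp [hvaΨ p hp]
  have cN1 : Continuous N1 := continuous_weight_mul₂ hN1c (cΨ.pow 2) ha fun p hp => by simp [hvaΨ p hp]
  have cY : Continuous Y := continuous_weight_mul₂ hWc (cdθ.pow 2) ha fun p hp => by simp [hvadθ p hp]
  have cX : Continuous X := continuous_weight_mul₂ hWc (cχ.pow 2) ha fun p hp => by simp [hvaχ p hp]
  have sΨ : HasCompactSupport fun p : ℝ × ℝ => Ψ p.1 p.2 := hΨs
  have supp_of : ∀ (F : ℝ × ℝ → ℝ) (g : ℝ × ℝ → ℝ), HasCompactSupport g → (∀ p, g p = 0 → F p = 0) → HasCompactSupport F :=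
    fun F g hg h => hg.mono fun p hp => by
      contrapose! hp
      simp only [mem_support, ne_eq, not_not] at hp ⊢
      exact h p hp
  have sA : HasCompactSupport A := supp_of A _ sΨ fun p hp => by simp [hA, hp]
  have sB : HasCompactSupport Bf := supp_of Bf _ sΨ fun p hp => by simp [hBf, hp]
  have sC : HasCompactSupport C := supp_of C _ sΨ fun p hp => by simp [hC, hp]
  have sD : HasCompactSupport D := supp_of D _ hs fun p hp => by simp only [hD]; simp [show χ p.1 p.2 = 0 from hp]
  have sE : HasCompactSupport E := supp_of E _ sΨ fun p hp => by simp [hE, hp]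
  have sZ : HasCompactSupport Z := supp_of Z _ hdzΨs fun p hp => by simp only [hZ]; simp [show dz Ψ p.1 p.2 = 0 from hp]
  have sM2 : HasCompactSupport M2 := supp_of M2 _ sΨ fun p hp => by simp [hM2, hp]
  have sN1 : HasCompactSupport N1 := supp_of N1 _ sΨ fun p hp => by simp [hN1, hp]
  have sY : HasCompactSupport Y := supp_of Y _ hdθΨs fun p hp => by simp only [hY]; simp [show dθ Ψ p.1 p.2 = 0 from hp]
  have sX : HasCompactSupport X := supp_of X _ hs fun p hp => by simp only [hX]; simp [show χ p.1 p.2 = 0 from hp]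
  have iA : Integrable A := cA.integrable_of_hasCompactSupport sA
  have iB : Integrable Bf := cB.integrable_of_hasCompactSupport sB
  have iC : Integrable C := cC.integrable_of_hasCompactSupport sC
  have iD : Integrable D := cD.integrable_of_hasCompactSupport sD
  have iE : Integrable E := cE.integrable_of_hasCompactSupport sE
  have iZ : Integrable Z := cZ.integrable_of_hasCompactSupport sZ
  have iM2 : Integrable M2 := cM2.integrable_of_hasCompactSupport sM2
  have iN1 : Integrable N1 := cN1.integrable_of_hasCompactSupport sN1
  have iY : Integrable Y := cY.integrable_of_hasCompactSupport sY
  have iX : Integrable X := cX.integrable_of_hasCompactSupport sX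
  -- pointwise on the strip
  have hpt : ∀ p ∈ strip, ellipticOp α Ψ p.1 p.2 * Ψ p.1 p.2 * W p.1 =
      α ^ 2 * A p + α * (5 + α) * Bf p + C p + D p - 6 * E p := by
    intro p hp
    have hcos : Real.cos p.2 ≠ 0 := (Real.cos_pos_of_mem_Ioo ⟨by linarith [hp.2.1, Real.pi_pos], hp.2.2⟩).ne'
    have hT : Real.cos p.2 * χ p.1 p.2 / Real.cos p.2 ^ 2 +
        Real.sin p.2 * (-Real.sin p.2 * χ p.1 p.2 + Real.cos p.2 * dθ χ p.1 p.2) / Real.cos p.2 =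
        Real.cos p.2 * χ p.1 p.2 + Real.sin p.2 * dθ χ p.1 p.2 := by
      rw [div_add_div _ _ (pow_ne_zero 2 hcos) hcos, div_eq_iff (mul_ne_zero (pow_ne_zero 2 hcos) hcos)]
      have := Real.sin_sq_add_cos_sq p.2
      linear_combination (-(Real.cos p.2 ^ 2 * χ p.1 p.2)) * this
    have hΨp : Ψ p.1 p.2 = Real.cos p.2 * χ p.1 p.2 := by rw [hΨ]
    have hdθp : dθ Ψ p.1 p.2 = -Real.sin p.2 * χ p.1 p.2 + Real.cos p.2 * dθ χ p.1 p.2 := by rw [hΨ, dθ_cosProfile hχ1]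
    have hud : DifferentiableAt ℝ (fun θ' => Ψ p.1 θ') p.2 :=
      ((hΨ2.comp (contDiff_const.prodMk contDiff_id)).differentiable (by simp)) p.2
    rw [ellipticOp_eq_expanded α hud hcos]
    simp only [hA, hBf, hC, hD, hE, hM, hN]
    rw [hdθp, hΨp, hT]
    ring
  -- generic tools
  have sliceR_supp : ∀ (G : ℝ × ℝ → ℝ), HasCompactSupport G → ∀ θ : ℝ, HasCompactSupport fun R => G (R, θ) :=
    fun G hG θ => HasCompactSupport.of_support_subset_isCompact (hG.image continuous_fst) fun R hR =>
      ⟨(R, θ), subset_tsupport G hR, rfl⟩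
  have vanishR : ∀ (G : ℝ × ℝ → ℝ), Integrable G → (∀ θ ∈ Ioo 0 (π / 2), ∫ R in Ioi (0 : ℝ), G (R, θ) = 0) →
      ∫ p in strip, G p = 0 := fun G hG h => by
    rw [integral_strip_eq_integral_Ioo_integral_Ioi hG]; exact setIntegral_eq_zero_of_forall_eq_zero h
  have vanishθ : ∀ (G : ℝ × ℝ → ℝ), Integrable G → (∀ R ∈ Ioi (0 : ℝ), ∫ θ in Ioo 0 (π / 2), G (R, θ) = 0) →
      ∫ p in strip, G p = 0 := fun G hG h => by
    rw [integral_strip_eq_integral_Ioi_integral_Ioo hG]; exact setIntegral_eq_zero_of_forall_eq_zero h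
  have intR : ∀ (G : ℝ × ℝ → ℝ), Continuous G → HasCompactSupport G → ∀ θ, Integrable fun R => G (R, θ) :=
    fun G hG hGs θ => (hG.comp (Continuous.prodMk_left θ)).integrable_of_hasCompactSupport (sliceR_supp G hGs θ)
  have intθ : ∀ (G : ℝ × ℝ → ℝ), Continuous G → ∀ R, IntegrableOn (fun θ => G (R, θ)) (Ioo 0 (π / 2)) :=
    fun G hG R => ((hG.comp (Continuous.prodMk_right R)).continuousOn.integrableOn_Icc (a := 0) (b := π / 2)).mono_set
      Ioo_subset_Icc_self
  have toIoo : ∀ (g : ℝ → ℝ), ∫ θ in (0 : ℝ)..(π / 2), g θ = ∫ θ in Ioo 0 (π / 2), g θ := fun g => by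
    rw [intervalIntegral.integral_of_le (by positivity), integral_Ioc_eq_integral_Ioo]
  -- slices of `Ψ`
  have hvR : ∀ θ, ContDiff ℝ 2 fun R => Ψ R θ := fun θ => hΨ2.comp (contDiff_id.prodMk contDiff_const)
  have huθ : ∀ R, ContDiff ℝ 2 fun θ => Ψ R θ := fun R => hΨ2.comp (contDiff_const.prodMk contDiff_id)
  have hχθ : ∀ R, ContDiff ℝ 1 fun θ => χ R θ := fun R => hχ1.comp (contDiff_const.prodMk contDiff_id)
  have hdv : ∀ θ, deriv (fun R => Ψ R θ) = fun R => dz Ψ R θ := fun θ => rfl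
  have hddv : ∀ θ, deriv (deriv fun R => Ψ R θ) = fun R => dz (dz Ψ) R θ := fun θ => by rw [hdv θ]; rfl
  have hdu : ∀ R, deriv (fun θ => Ψ R θ) = fun θ => dθ Ψ R θ := fun R => rfl
  have hddu : ∀ R, deriv (deriv fun θ => Ψ R θ) = fun θ => dθ (dθ Ψ) R θ := fun R => by rw [hdu R]; rfl
  have hdχ : ∀ R, deriv (fun θ => χ R θ) = fun θ => dθ χ R θ := fun R => rfl
  have hvs : ∀ θ, HasCompactSupport fun R => Ψ R θ := fun θ => sliceR_supp (fun p => Ψ p.1 p.2) sΨ θ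
  have hvsub : ∀ θ, tsupport (fun R => Ψ R θ) ⊆ Ioi 0 := by
    intro θ
    refine (closure_minimal (fun R hR => ?_) isClosed_Ici).trans (Ici_subset_Ioi.2 ha)
    by_contra h
    exact hR (hvaΨ (R, θ) (not_le.1 h))
  -- TERM A: `∫∫A = ∫∫Z − ½∫∫M2`
  have hTA : ∫ p in strip, A p = (∫ p in strip, Z p) - (1 / 2) * ∫ p in strip, M2 p := by
    have h0 := vanishR (fun p => A p - Z p + (1 / 2) * M2 p) ((iA.sub iZ).add (iM2.const_mul _)) (fun θ _ => by
      have h1 := integral_Ioi_neg_weight_mul_deriv2_mul hMd (hvR θ) (hvs θ) (hvsub θ)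
      rw [hddv θ, hdv θ] at h1
      simp only at h1
      have j1 : IntegrableOn (fun R => M R * (-(dz (dz Ψ) R θ) * Ψ R θ)) (Ioi 0) := (intR A cA sA θ).integrableOn
      have j2 : IntegrableOn (fun R => W R * (R * dz Ψ R θ) ^ 2) (Ioi 0) := (intR Z cZ sZ θ).integrableOn
      have j3 : IntegrableOn (fun R => (1 / 2) * (deriv (deriv M) R * Ψ R θ ^ 2)) (Ioi 0) := ((intR M2 cM2 sM2 θ).const_mul _).integrableOn
      have j12 : IntegrableOn (fun R => M R * (-(dz (dz Ψ) R θ) * Ψ R θ) - W R * (R * dz Ψ R θ) ^ 2) (Ioi 0) := j1.sub j2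
      simp only [hA, hZ, hM2]
      rw [integral_add j12 j3, integral_sub j1 j2, MeasureTheory.integral_const_mul]
      have e1 : ∫ R in Ioi (0 : ℝ), M R * (-(dz (dz Ψ) R θ) * Ψ R θ) = ∫ R in Ioi (0 : ℝ), -(M R * dz (dz Ψ) R θ) * Ψ R θ :=
        integral_congr_ae (ae_of_all _ fun R => by ring)
      have e2 : ∫ R in Ioi (0 : ℝ), W R * (R * dz Ψ R θ) ^ 2 = ∫ R in Ioi (0 : ℝ), M R * dz Ψ R θ ^ 2 :=
        integral_congr_ae (ae_of_all _ fun R => by simp only [hM]; ring)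
      rw [e1, e2, h1]; ring)
    have k1 : IntegrableOn (fun p => A p - Z p) strip := (iA.sub iZ).integrableOn
    have k2 : IntegrableOn (fun p => (1 / 2) * M2 p) strip := (iM2.const_mul _).integrableOn
    rw [integral_add k1 k2, integral_sub iA.integrableOn iZ.integrableOn, MeasureTheory.integral_const_mul] at h0
    linarith
  -- TERM B: `∫∫B = ½∫∫N1`
  have hTB : ∫ p in strip, Bf p = (1 / 2) * ∫ p in strip, N1 p := by
    have h0 := vanishR (fun p => Bf p - (1 / 2) * N1 p) (iB.sub (iN1.const_mul _)) (fun θ _ => by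
      have h1 := integral_Ioi_neg_weight_mul_deriv_mul hNd ((hvR θ).of_le (by norm_num)) (hvs θ) (hvsub θ)
      rw [hdv θ] at h1
      simp only at h1
      have j1 : IntegrableOn (fun R => N R * (-(dz Ψ R θ) * Ψ R θ)) (Ioi 0) := (intR Bf cB sB θ).integrableOn
      have j3 : IntegrableOn (fun R => (1 / 2) * (deriv N R * Ψ R θ ^ 2)) (Ioi 0) := ((intR N1 cN1 sN1 θ).const_mul _).integrableOn
      simp only [hBf, hN1]
      rw [integral_sub j1 j3, MeasureTheory.integral_const_mul]
      have e1 : ∫ R in Ioi (0 : ℝ), N R * (-(dz Ψ R θ) * Ψ R θ) = ∫ R in Ioi (0 : ℝ), -(N R * dz Ψ R θ) * Ψ R θ :=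
        integral_congr_ae (ae_of_all _ fun R => by ring)
      rw [e1, h1]; ring)
    have k2 : IntegrableOn (fun p => (1 / 2) * N1 p) strip := (iN1.const_mul _).integrableOn
    rw [integral_sub iB.integrableOn k2, MeasureTheory.integral_const_mul] at h0
    linarith
  -- TERM C: `∫∫C = ∫∫Y`
  have hTC : ∫ p in strip, C p = ∫ p in strip, Y p := by
    have h0 := vanishθ (fun p => C p - Y p) (iC.sub iY) (fun R _ => by
      have h1 := integral_neg_deriv2_mul_dirichlet (huθ R) (hD0 R) (hD1 R)
      rw [hddu R, hdu R, toIoo, toIoo] at h1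
      simp only at h1
      have j1 : IntegrableOn (fun θ => W R * (-dθ (dθ Ψ) R θ * Ψ R θ)) (Ioo 0 (π / 2)) := intθ C cC R
      have j2 : IntegrableOn (fun θ => W R * dθ Ψ R θ ^ 2) (Ioo 0 (π / 2)) := intθ Y cY R
      simp only [hC, hY]
      rw [integral_sub j1 j2, MeasureTheory.integral_const_mul, MeasureTheory.integral_const_mul, h1]; ring)
    rw [integral_sub iC.integrableOn iY.integrableOn] at h0
    linarith
  -- TERM D: `∫∫D = ½∫∫X`
  have hTD : ∫ p in strip, D p = (1 / 2) * ∫ p in strip, X p := by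
    have h0 := vanishθ (fun p => D p - (1 / 2) * X p) (iD.sub (iX.const_mul _)) (fun R _ => by
      have h1 := integral_tanTerm_mul (hχθ R)
      rw [hdχ R, toIoo, toIoo] at h1
      simp only at h1
      have j1 : IntegrableOn (fun θ => W R * ((Real.cos θ * χ R θ + Real.sin θ * dθ χ R θ) * (Real.cos θ * χ R θ))) (Ioo 0 (π / 2)) :=
        intθ D cD R
      have j2 : IntegrableOn (fun θ => (1 / 2) * (W R * χ R θ ^ 2)) (Ioo 0 (π / 2)) := (intθ X cX R).const_mul _
      simp only [hD, hX]
      rw [integral_sub j1 j2, MeasureTheory.integral_const_mul, MeasureTheory.integral_const_mul,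
        MeasureTheory.integral_const_mul, h1]; ring)
    have k2 : IntegrableOn (fun p => (1 / 2) * X p) strip := (iX.const_mul _).integrableOn
    rw [integral_sub iD.integrableOn k2, MeasureTheory.integral_const_mul] at h0
    linarith
  -- assemble
  rw [setIntegral_congr_fun measurableSet_strip hpt]
  have i1 : IntegrableOn (fun p => α ^ 2 * A p) strip := (iA.const_mul _).integrableOn
  have i2 : IntegrableOn (fun p => α * (5 + α) * Bf p) strip := (iB.const_mul _).integrableOn
  have i5 : IntegrableOn (fun p => 6 * E p) strip := (iE.const_mul _).integrableOn
  have k12 : IntegrableOn (fun p => α ^ 2 * A p + α * (5 + α) * Bf p) strip := i1.add i2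
  have k123 : IntegrableOn (fun p => α ^ 2 * A p + α * (5 + α) * Bf p + C p) strip := k12.add iC.integrableOn
  have k1234 : IntegrableOn (fun p => α ^ 2 * A p + α * (5 + α) * Bf p + C p + D p) strip := k123.add iD.integrableOn
  rw [integral_sub k1234 i5, integral_add k123 iD.integrableOn, integral_add k12 iC.integrableOn, integral_add i1 i2,
    MeasureTheory.integral_const_mul, MeasureTheory.integral_const_mul, MeasureTheory.integral_const_mul, hTA, hTB, hTC, hTD]
  simp only [hZ, hM2, hN1, hY, hE, hX]
  ring

end Elgindi

end Literature.Analysis.FluidPDE
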